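import Mathlib
import Summits.NavierStokesRegularity.NavierStokesRegularity.Theorems.DssFarFieldSlavingBlowupTypeIDssProfileSimilarityEnstrophyDecay
import HarnessLib

/-!
# Similarity enstrophy, file 3/4: integrability of the enstrophy budget under (D) (pub-ns-dss theory
  T38-SCOPE (S1); route `DssFarFieldSlaving`, crux `BlowupTypeIDssProfile`,
  stmt-NavierStokesRegularity-0155 — SUPPORT, label-free helper; typer seat g6, 2026-08-23)

HONEST FRAMING. Label-free analysis helper for the T38-SCOPE plan of the cell's theory seat (S3 → S2 → S1 → S4;
LIOUVILLE-SIDE l.177): an IDENTITY / estimates for a HYPOTHETICAL object (the similarity vorticity of a Type-I ancient mild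
field) under the NAMED space–time decay hypothesis (D), which is NOT derived from Type-I membership here. No census words
change (the explicit rows T31″ / T34 / T38 stay DERIVED until S4 lands); nothing numeric; nothing here bears on Navier–Stokes
regularity or blow-up. Idea credit for the Hardy-weighted stretching threshold: the OPEN item
`StretchingWellBinding.DssProfileBinding` (stmt-1578), not addressed here.

CONTENTS. With the pointwise bounds of file 2, on `ℝ³`: `|Ω(s)|²`, `|∇Ω(s)|²_F`, `⟪ΔΩ,Ω⟫`,
`⟪DΩ(y)y,Ω⟫`, `⟪(U·∇)Ω,Ω⟫`, `⟪Ω,DU Ω⟫ ∈ L¹` for every `s` (each `≲ (1+|y|)^{−4}`, integrable in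
dimension `3`: `integrable_of_norm_le_const_mul_decay`).
[this file; folklore; theory T38-SCOPE (S1)]
-/

noncomputable section

set_option linter.dupNamespace false

namespace Summit.NavierStokesRegularity.NavierStokesRegularity.Theorems.SimilarityEnstrophy

open MeasureTheory Set Filter Topology Module Metric InnerProductSpace Function
open scoped RealInnerProductSpace Laplacian ContDiff
open Literature.Analysis Literature.Analysis.FluidPDE
open Summit.NavierStokesRegularity.NavierStokesRegularity.Theorems.GaussianGap
open Summit.NavierStokesRegularity.NavierStokesRegularity.Theorems.PlanarEnergyAPriori

variable {M : ℝ} {V : ℝ → EuclideanSpace ℝ (Fin 3) → EuclideanSpace ℝ (Fin 3)}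

/-! ### Integrability of the enstrophy budget under (D) -/

section Integrability

variable (hV : IsTypeIAncientMild M V) {C₁ C₂ C₃ : ℝ}
  (hD1 : ∀ t < 0, ∀ x, (‖x‖ + Real.sqrt (-t)) ^ (1 + 1) * ‖iteratedFDeriv ℝ 1 (V t) x‖ ≤ C₁)
  (hD2 : ∀ t < 0, ∀ x, (‖x‖ + Real.sqrt (-t)) ^ (2 + 1) * ‖iteratedFDeriv ℝ 2 (V t) x‖ ≤ C₂)
  (hD3 : ∀ t < 0, ∀ x, (‖x‖ + Real.sqrt (-t)) ^ (3 + 1) * ‖iteratedFDeriv ℝ 3 (V t) x‖ ≤ C₃)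
include hV

/-- Smoothness bookkeeping: the similarity slices and vorticity slices are `C^∞`. [folklore] -/
theorem contDiff_lerayVorticity_slice (s : ℝ) : ContDiff ℝ ∞ (lerayVorticity V s) := by
  rw [show lerayVorticity V s = curl (lerayOrbit V s) from rfl]
  exact contDiff_curl (contDiff_lerayOrbit_slice_of_typeI hV s (by norm_cast))

include hD1 in
/-- **The similarity enstrophy density is integrable:** `|Ω(s)|² ∈ L¹(ℝ³)` for every `s`
(`|Ω| ≲ (1 + |y|)^{−2}`). [folklore] -/
theorem integrable_norm_lerayVorticity_sq (s : ℝ) :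
    Integrable fun y => ‖lerayVorticity V s y‖ ^ 2 := by
  have hc := (contDiff_lerayVorticity_slice hV s).continuous
  refine integrable_of_norm_le_const_mul_decay (hc.norm.pow 2) (r := 4)
    (C₁ := (‖curlCLM‖ * C₁) ^ 2) (C₂ := 1) (by rw [finrank_euclideanSpace_fin]; norm_num) fun y => ?_
  rw [norm_pow, norm_norm, one_mul]
  have h := norm_lerayVorticity_le_decay hV hD1 s y
  have h0 : 0 ≤ ‖curlCLM‖ * C₁ * (1 + ‖y‖) ^ (-(2 : ℝ)) := (norm_nonneg _).trans h
  calc ‖lerayVorticity V s y‖ ^ 2 ≤ (‖curlCLM‖ * C₁ * (1 + ‖y‖) ^ (-(2 : ℝ))) ^ 2 :=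
        pow_le_pow_left₀ (norm_nonneg _) h 2
    _ = (‖curlCLM‖ * C₁) ^ 2 * ((1 + ‖y‖) ^ (-(2 : ℝ)) * (1 + ‖y‖) ^ (-(2 : ℝ))) := by ring
    _ = (‖curlCLM‖ * C₁) ^ 2 * (1 + ‖y‖) ^ (-(4 : ℝ)) := by rw [SlabLaw.rpow_neg_mul_rpow_neg]; norm_num

include hD2 in
/-- `|∇Ω(s)|²_F ∈ L¹(ℝ³)` (`|DΩ| ≲ (1+|y|)^{−3}`, `|·|²_F ≤ 3 ‖·‖²`). [folklore] -/
theorem integrable_frobeniusNormSq_fderiv_lerayVorticity (s : ℝ) :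
    Integrable fun y => frobeniusNormSq (fderiv ℝ (lerayVorticity V s) y) := by
  have hc : Continuous fun y => frobeniusNormSq (fderiv ℝ (lerayVorticity V s) y) := by
    unfold frobeniusNormSq
    exact continuous_finsetSum _ fun i _ =>
      ((((contDiff_lerayVorticity_slice hV s).continuous_fderiv (by simp)).clm_apply
        continuous_const).norm).pow 2
  refine integrable_of_norm_le_const_mul_decay hc (r := 6)
    (C₁ := 3 * (‖curlCLM‖ * C₂) ^ 2) (C₂ := 1) (by rw [finrank_euclideanSpace_fin]; norm_num) fun y => ?_
  rw [Real.norm_of_nonneg (frobeniusNormSq_nonneg _), one_mul]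
  have h := norm_fderiv_lerayVorticity_le_decay hV hD2 s y
  have h0 : 0 ≤ ‖curlCLM‖ * C₂ * (1 + ‖y‖) ^ (-(3 : ℝ)) := (norm_nonneg _).trans h
  calc frobeniusNormSq (fderiv ℝ (lerayVorticity V s) y)
      ≤ 3 * ‖fderiv ℝ (lerayVorticity V s) y‖ ^ 2 := frobeniusNormSq_le_three_mul _
    _ ≤ 3 * (‖curlCLM‖ * C₂ * (1 + ‖y‖) ^ (-(3 : ℝ))) ^ 2 :=
        mul_le_mul_of_nonneg_left (pow_le_pow_left₀ (norm_nonneg _) h 2) (by norm_num)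
    _ = 3 * (‖curlCLM‖ * C₂) ^ 2 * ((1 + ‖y‖) ^ (-(3 : ℝ)) * (1 + ‖y‖) ^ (-(3 : ℝ))) := by ring
    _ = 3 * (‖curlCLM‖ * C₂) ^ 2 * (1 + ‖y‖) ^ (-(6 : ℝ)) := by rw [SlabLaw.rpow_neg_mul_rpow_neg]; norm_num

end Integrability

/-- A generic integrability criterion for the budget terms: a continuous pairing bounded by
`K (1 + ‖y‖)^{−4}` is integrable on `ℝ³`. [folklore] -/
theorem integrable_of_le_decay_four {φ : EuclideanSpace ℝ (Fin 3) → ℝ} (hφ : Continuous φ) {K : ℝ}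
    (h : ∀ y, ‖φ y‖ ≤ K * (1 + ‖y‖) ^ (-(4 : ℝ))) : Integrable φ :=
  integrable_of_norm_le_const_mul_decay hφ (r := 4) (C₁ := K) (C₂ := 1)
    (by rw [finrank_euclideanSpace_fin]; norm_num) fun y => by rw [one_mul]; exact h y

section Integrability2

variable (hV : IsTypeIAncientMild M V) {C₁ C₂ C₃ : ℝ}
  (hD1 : ∀ t < 0, ∀ x, (‖x‖ + Real.sqrt (-t)) ^ (1 + 1) * ‖iteratedFDeriv ℝ 1 (V t) x‖ ≤ C₁)
  (hD2 : ∀ t < 0, ∀ x, (‖x‖ + Real.sqrt (-t)) ^ (2 + 1) * ‖iteratedFDeriv ℝ 2 (V t) x‖ ≤ C₂)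
  (hD3 : ∀ t < 0, ∀ x, (‖x‖ + Real.sqrt (-t)) ^ (3 + 1) * ‖iteratedFDeriv ℝ 3 (V t) x‖ ≤ C₃)
include hV

include hD1 hD3 in
/-- `⟪ΔΩ(s), Ω(s)⟫ ∈ L¹(ℝ³)`. [folklore] -/
theorem integrable_inner_laplacian_lerayVorticity (s : ℝ) :
    Integrable fun y => ⟪(Δ (lerayVorticity V s)) y, lerayVorticity V s y⟫ := by
  have hΩ := contDiff_lerayVorticity_slice hV s
  refine integrable_of_le_decay_four
    ((continuous_laplacian (hΩ.of_le (by norm_cast))).inner hΩ.continuous)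
    (K := 3 * (‖curlCLM‖ * C₃) * (‖curlCLM‖ * C₁)) fun y => ?_
  have h1 := norm_laplacian_lerayVorticity_le_decay hV hD3 s y
  have h2 := norm_lerayVorticity_le_decay hV hD1 s y
  have h10 : 0 ≤ 3 * (‖curlCLM‖ * C₃) * (1 + ‖y‖) ^ (-(4 : ℝ)) := (norm_nonneg _).trans h1
  calc ‖⟪(Δ (lerayVorticity V s)) y, lerayVorticity V s y⟫‖
      ≤ ‖(Δ (lerayVorticity V s)) y‖ * ‖lerayVorticity V s y‖ := norm_inner_le_norm _ _
    _ ≤ (3 * (‖curlCLM‖ * C₃) * (1 + ‖y‖) ^ (-(4 : ℝ))) * (‖curlCLM‖ * C₁ * (1 + ‖y‖) ^ (-(2 : ℝ))) :=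
        mul_le_mul h1 h2 (norm_nonneg _) h10
    _ = 3 * (‖curlCLM‖ * C₃) * (‖curlCLM‖ * C₁) * (1 + ‖y‖) ^ (-((4 : ℝ) + 2)) := by
        rw [← SlabLaw.rpow_neg_mul_rpow_neg]; ring
    _ ≤ 3 * (‖curlCLM‖ * C₃) * (‖curlCLM‖ * C₁) * (1 + ‖y‖) ^ (-(4 : ℝ)) := by
        have hK : 0 ≤ 3 * (‖curlCLM‖ * C₃) * (‖curlCLM‖ * C₁) := by
          have := decayConst_nonneg hD1; have := decayConst_nonneg hD3; positivity
        exact mul_le_mul_of_nonneg_left (SlabLaw.rpow_neg_le_rpow_neg_of_le y (by norm_num)) hK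

include hD1 hD2 in
/-- `⟪DΩ(s)(y) y, Ω(s)(y)⟫ ∈ L¹(ℝ³)` (the Leray drift pairing; `|y| |DΩ| |Ω| ≲ (1+|y|)^{−4}`). [folklore] -/
theorem integrable_inner_fderiv_self_lerayVorticity (s : ℝ) :
    Integrable fun y => ⟪fderiv ℝ (lerayVorticity V s) y y, lerayVorticity V s y⟫ := by
  have hΩ := contDiff_lerayVorticity_slice hV s
  refine integrable_of_le_decay_four
    (((hΩ.continuous_fderiv (by simp)).clm_apply continuous_id).inner hΩ.continuous)
    (K := (‖curlCLM‖ * C₂) * (‖curlCLM‖ * C₁)) fun y => ?_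
  have h1 := norm_fderiv_lerayVorticity_le_decay hV hD2 s y
  have h2 := norm_lerayVorticity_le_decay hV hD1 s y
  have h20 : 0 ≤ ‖curlCLM‖ * C₁ * (1 + ‖y‖) ^ (-(2 : ℝ)) := (norm_nonneg _).trans h2
  have hA : ‖fderiv ℝ (lerayVorticity V s) y y‖ ≤ ‖curlCLM‖ * C₂ * (1 + ‖y‖) ^ (-(2 : ℝ)) := by
    calc ‖fderiv ℝ (lerayVorticity V s) y y‖ ≤ ‖fderiv ℝ (lerayVorticity V s) y‖ * ‖y‖ :=
          ContinuousLinearMap.le_opNorm _ _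
      _ ≤ ‖curlCLM‖ * C₂ * (1 + ‖y‖) ^ (-(3 : ℝ)) * ‖y‖ := mul_le_mul_of_nonneg_right h1 (norm_nonneg _)
      _ = ‖curlCLM‖ * C₂ * (‖y‖ * (1 + ‖y‖) ^ (-(3 : ℝ))) := by ring
      _ ≤ ‖curlCLM‖ * C₂ * (1 + ‖y‖) ^ (-((3 : ℝ) - 1)) := by
          have hc : 0 ≤ ‖curlCLM‖ * C₂ := by have := decayConst_nonneg hD2; positivity
          exact mul_le_mul_of_nonneg_left (norm_mul_decay_le y 3) hc
      _ = ‖curlCLM‖ * C₂ * (1 + ‖y‖) ^ (-(2 : ℝ)) := by norm_num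
  have hA0 : 0 ≤ ‖curlCLM‖ * C₂ * (1 + ‖y‖) ^ (-(2 : ℝ)) := (norm_nonneg _).trans hA
  calc ‖⟪fderiv ℝ (lerayVorticity V s) y y, lerayVorticity V s y⟫‖
      ≤ ‖fderiv ℝ (lerayVorticity V s) y y‖ * ‖lerayVorticity V s y‖ := norm_inner_le_norm _ _
    _ ≤ (‖curlCLM‖ * C₂ * (1 + ‖y‖) ^ (-(2 : ℝ))) * (‖curlCLM‖ * C₁ * (1 + ‖y‖) ^ (-(2 : ℝ))) :=
        mul_le_mul hA h2 (norm_nonneg _) hA0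
    _ = (‖curlCLM‖ * C₂) * (‖curlCLM‖ * C₁) * (1 + ‖y‖) ^ (-(4 : ℝ)) := by
        rw [show (-(4 : ℝ)) = -((2 : ℝ) + 2) by norm_num, ← SlabLaw.rpow_neg_mul_rpow_neg]; ring

include hD1 hD2 in
/-- `⟪(U(s)·∇)Ω(s), Ω(s)⟫ ∈ L¹(ℝ³)` (transport pairing; `U` bounded by the Type-I constant). [folklore] -/
theorem integrable_inner_convect_lerayVorticity (s : ℝ) :
    Integrable fun y => ⟪convect (lerayOrbit V s) (lerayVorticity V s) y, lerayVorticity V s y⟫ := by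
  have hΩ := contDiff_lerayVorticity_slice hV s
  have hU := contDiff_lerayOrbit_slice_of_typeI hV s (n := 1) (by norm_cast)
  have hc : Continuous fun y => ⟪convect (lerayOrbit V s) (lerayVorticity V s) y, lerayVorticity V s y⟫ := by
    simp only [convect]
    exact ((hΩ.continuous_fderiv (by simp)).clm_apply hU.continuous).inner hΩ.continuous
  refine integrable_of_le_decay_four hc (K := (‖curlCLM‖ * C₂) * M * (‖curlCLM‖ * C₁)) fun y => ?_
  have h1 := norm_fderiv_lerayVorticity_le_decay hV hD2 s y
  have h2 := norm_lerayVorticity_le_decay hV hD1 s y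
  have hU0 := norm_lerayOrbit_le_of_typeI hV s y
  have hM : 0 ≤ M := hV.nonneg
  have h10 : 0 ≤ ‖curlCLM‖ * C₂ * (1 + ‖y‖) ^ (-(3 : ℝ)) := (norm_nonneg _).trans h1
  simp only [convect]
  calc ‖⟪fderiv ℝ (lerayVorticity V s) y (lerayOrbit V s y), lerayVorticity V s y⟫‖
      ≤ ‖fderiv ℝ (lerayVorticity V s) y (lerayOrbit V s y)‖ * ‖lerayVorticity V s y‖ :=
        norm_inner_le_norm _ _
    _ ≤ (‖fderiv ℝ (lerayVorticity V s) y‖ * ‖lerayOrbit V s y‖) * ‖lerayVorticity V s y‖ :=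
        mul_le_mul_of_nonneg_right (ContinuousLinearMap.le_opNorm _ _) (norm_nonneg _)
    _ ≤ (‖curlCLM‖ * C₂ * (1 + ‖y‖) ^ (-(3 : ℝ)) * M) * (‖curlCLM‖ * C₁ * (1 + ‖y‖) ^ (-(2 : ℝ))) :=
        mul_le_mul (mul_le_mul h1 hU0 (norm_nonneg _) h10) h2 (norm_nonneg _) (mul_nonneg h10 hM)
    _ = (‖curlCLM‖ * C₂) * M * (‖curlCLM‖ * C₁) * (1 + ‖y‖) ^ (-((3 : ℝ) + 2)) := by
        rw [← SlabLaw.rpow_neg_mul_rpow_neg]; ring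
    _ ≤ (‖curlCLM‖ * C₂) * M * (‖curlCLM‖ * C₁) * (1 + ‖y‖) ^ (-(4 : ℝ)) := by
        have hK : 0 ≤ (‖curlCLM‖ * C₂) * M * (‖curlCLM‖ * C₁) := by
          have := decayConst_nonneg hD1; have := decayConst_nonneg hD2; positivity
        exact mul_le_mul_of_nonneg_left (SlabLaw.rpow_neg_le_rpow_neg_of_le y (by norm_num)) hK

include hD1 in
/-- The stretching pairing `⟪Ω(s), DU(s) Ω(s)⟫ ∈ L¹(ℝ³)`. [folklore] -/
theorem integrable_inner_stretching_lerayVorticity (s : ℝ) :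
    Integrable fun y => ⟪lerayVorticity V s y, fderiv ℝ (lerayOrbit V s) y (lerayVorticity V s y)⟫ := by
  have hΩ := contDiff_lerayVorticity_slice hV s
  have hU := contDiff_lerayOrbit_slice_of_typeI hV s (n := 1) (by norm_cast)
  refine integrable_of_le_decay_four
    (hΩ.continuous.inner ((hU.continuous_fderiv (by simp)).clm_apply hΩ.continuous))
    (K := (‖curlCLM‖ * C₁) * (C₁ * (‖curlCLM‖ * C₁))) fun y => ?_
  have h1 := norm_fderiv_lerayOrbit_le_decay hV hD1 s y
  have h2 := norm_lerayVorticity_le_decay hV hD1 s y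
  have h10 : 0 ≤ C₁ * (1 + ‖y‖) ^ (-(2 : ℝ)) := (norm_nonneg _).trans h1
  have h20 : 0 ≤ ‖curlCLM‖ * C₁ * (1 + ‖y‖) ^ (-(2 : ℝ)) := (norm_nonneg _).trans h2
  calc ‖⟪lerayVorticity V s y, fderiv ℝ (lerayOrbit V s) y (lerayVorticity V s y)⟫‖
      ≤ ‖lerayVorticity V s y‖ * ‖fderiv ℝ (lerayOrbit V s) y (lerayVorticity V s y)‖ :=
        norm_inner_le_norm _ _
    _ ≤ ‖lerayVorticity V s y‖ * (‖fderiv ℝ (lerayOrbit V s) y‖ * ‖lerayVorticity V s y‖) :=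
        mul_le_mul_of_nonneg_left (ContinuousLinearMap.le_opNorm _ _) (norm_nonneg _)
    _ ≤ (‖curlCLM‖ * C₁ * (1 + ‖y‖) ^ (-(2 : ℝ))) *
          ((C₁ * (1 + ‖y‖) ^ (-(2 : ℝ))) * (‖curlCLM‖ * C₁ * (1 + ‖y‖) ^ (-(2 : ℝ)))) :=
        mul_le_mul h2 (mul_le_mul h1 h2 (norm_nonneg _) h10) (by positivity) h20
    _ = (‖curlCLM‖ * C₁) * (C₁ * (‖curlCLM‖ * C₁)) * (1 + ‖y‖) ^ (-(((2 : ℝ) + 2) + 2)) := by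
        rw [← SlabLaw.rpow_neg_mul_rpow_neg, ← SlabLaw.rpow_neg_mul_rpow_neg]; ring
    _ ≤ (‖curlCLM‖ * C₁) * (C₁ * (‖curlCLM‖ * C₁)) * (1 + ‖y‖) ^ (-(4 : ℝ)) := by
        have hK : 0 ≤ (‖curlCLM‖ * C₁) * (C₁ * (‖curlCLM‖ * C₁)) := by
          have := decayConst_nonneg hD1; positivity
        exact mul_le_mul_of_nonneg_left (SlabLaw.rpow_neg_le_rpow_neg_of_le y (by norm_num)) hK

end Integrability2

end Summit.NavierStokesRegularity.NavierStokesRegularity.Theorems.SimilarityEnstrophy
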